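import Summits.CriticalPhenomena.CardyFormulaZ2.Theses.CardySelfDualSegment
import Summits.CriticalPhenomena.CardyFormulaZ2.Theorems.CardySelfDualSegmentSegmentClosedConfinementGates
import Summits.CriticalPhenomena.CardyFormulaZ2.Theorems.CardySelfDualSegmentSegmentClosedStubInscribedTB
import Summits.CriticalPhenomena.CardyFormulaZ2.Theorems.CardySelfDualSegmentSegmentClosedStubIndepBoxes
import Summits.CriticalPhenomena.CardyFormulaZ2.Theorems.CardySelfDualSegmentSegmentClosedStubBoxCrossRatio
import Summits.CriticalPhenomena.CardyFormulaZ2.Theorems.CardySelfDualSegmentSegmentClosedStubIdentification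
import Literature.Probability.RandomPlanarGeometry.RectangleModulusAspectRatio
import Literature.Probability.RandomPlanarGeometry.CardyFunctionIncBeta
import Literature.Probability.RandomPlanarGeometry.ConformalRectangleProofs
import HarnessLib

/-!
# `SegmentClosed` (stmt-CriticalPhenomena-5473): the good set of the self-dual corner segment is closed

Route `CardySelfDualSegment` of `CriticalPhenomena/CardyFormulaZ2`, line `Sketch` of the crux:
assuming the uniform box-crossing property of the corner models `M_t` (UBC) and uniform
marginality (UM), the good set `G = {t ∈ [0,1] | ∃ α, 0 < im α ∧ CardyMod t α}` is closed.
* `im_ge_of_inscribed` (flat test): for `β ∈ ℍ`, `|re β| ≤ 5A/3` and `im β` small, `K₀` disjoint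
  squares inscribed in the sheared box `φ_β((0,2A)×(0,1))` between its two sides are crossed
  independently (`stub_inscribedTB`, `stub_indepBoxes`, UBC at aspect ratio `1`), so the crude
  crossing probability is `≥ 1 - (1 - c₁)^{K₀}` for small meshes.
* `stub_confinement` (the lead's registered stub): with the Cardy value `F(1 - η(w/h))` of a box
  crossed bottom-to-top (`stub_boxCrossRatio`) and a width `A` with `F(1 - η A) > 1 - c`, the
  forced-gate tests of `…ConfinementGates` give `im β ≤ 4A/3`, `|re β| ≤ 5A/3`, and the flat
  test gives `im β ≥ A/(6(K₀+1))`: `K = [-5A/3, 5A/3] × [A/(6(K₀+1)), 4A/3]`.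
* `segmentClosed_of_stubs` / `segmentClosed_proof`: test `CardyMod t α` on the pre-sheared boxes
  (`pullback_constant`, `β = (i - re α)/im α`), confine `β`, pass to limits by
  `stub_identification` (Radó + `3ε` via UM), and close by the projection `[0,1] × K → [0,1]`.
-/

noncomputable section

open Set Filter Metric MeasureTheory Complex
open scoped Topology
open UpperHalfPlane (upperHalfPlaneSet)
open Literature.Probability.RandomPlanarGeometry Literature.Probability.Percolation
open Literature.Probability.LatticeModels Literature.Barriers.CriticalPhenomena

namespace Summit.CriticalPhenomena.CardyFormulaZ2.Cruxes.SegmentClosed.Sketch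

/-- Shear bound inside the parallelogram: for `0 < s < 1`, `min 0 r ≤ r s ≤ max 0 r`. -/
theorem min_le_mul_le_max {r s : ℝ} (hs0 : 0 < s) (hs1 : s < 1) :
    min 0 r ≤ r * s ∧ r * s ≤ max 0 r := by
  rcases le_or_gt 0 r with hr | hr
  · rw [min_eq_left hr, max_eq_right hr]
    exact ⟨mul_nonneg hr hs0.le, mul_le_of_le_one_right hr hs1.le⟩
  · rw [min_eq_right hr.le, max_eq_left hr.le]
    refine ⟨?_, (mul_neg_of_neg_of_pos hr hs0).le⟩
    have := mul_le_mul_of_nonpos_left hs1.le hr.le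
    rwa [mul_one] at this

/-- `max 0 r - min 0 r = |r|`. -/
theorem max_sub_min_eq_abs (r : ℝ) : max 0 r - min 0 r = |r| := by
  rcases le_or_gt 0 r with hr | hr
  · rw [max_eq_right hr, min_eq_left hr, abs_of_nonneg hr]; ring
  · rw [max_eq_left hr.le, min_eq_right hr.le, abs_of_neg hr]; ring

/-- **Flat sheared boxes are crossed with probability near one.** Let `β ∈ ℍ` with
`|re β| ≤ 5A/3`, `A > 0`, and suppose the bottom-to-top crossings of the lattice squares
`w + [0, n]²`, `n ≥ n₁`, all have `M_t`-probability `≥ c₁`. If the crude `M_t`-crossing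
probabilities of the sheared box `φ_β((0,2A)×(0,1))` tend to `p` as the mesh `δ → 0⁺` and
`(1 - c₁)^{K₀} < 1 - p`, then `im β ≥ A / (6 (K₀ + 1))`: otherwise `K₀` disjoint inscribed
squares of side `n δ ≈ im β` fit between the two sides, and independence gives crude crossing
probability `≥ 1 - (1 - c₁)^{K₀} > p` for all small `δ`. -/
theorem im_ge_of_inscribed (t : unitInterval) {β : ℂ} (hβ : 0 < β.im) {A c₁ p : ℝ} (hA : 0 < A) (h2A : 0 < 2 * A) {n₁ K₀ : ℕ} (hbox : ∀ n : ℕ, n₁ ≤ n → ∀ w : ℂ, c₁ ≤ (cornerPercolation t).real (embTBCrossing (fun v => squareLatticeEmbedding.z v - w) n n)) (hr : |β.re| ≤ 5 * A / 3) (hK₀ : (1 - c₁) ^ K₀ < 1 - p) (hlim : Tendsto (cornerCrossingProb t ((rectQuad 0 (2 * A) 0 1 h2A one_pos).map (shearHomeomorph β hβ.ne'))) (𝓝[>] 0) (𝓝 p)) : A / (6 * (K₀ + 1)) ≤ β.im := by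
  -- `p ≥ 0`, so `K₀ = 0` is impossible
  have hp0 : 0 ≤ p := by
    refine ge_of_tendsto hlim (Eventually.of_forall fun δ => ?_)
    exact (cornerCrossingProb_mem_Icc t _ δ).1
  rcases Nat.eq_zero_or_pos K₀ with hK | hK
  · subst hK
    rw [pow_zero] at hK₀
    linarith
  have hKr : (1 : ℝ) ≤ K₀ := by exact_mod_cast hK
  by_contra H
  rw [not_le] at H
  have hKH : (K₀ : ℝ) * β.im < A / 6 := by
    have h1 : (K₀ : ℝ) * β.im < K₀ * (A / (6 * (K₀ + 1))) :=
      mul_lt_mul_of_pos_left H (by positivity)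
    have h2 : (K₀ : ℝ) * (A / (6 * (K₀ + 1))) ≤ A / 6 := by
      rw [mul_div_assoc', div_le_div_iff₀ (by positivity) (by positivity)]
      nlinarith [(Nat.cast_nonneg K₀ : (0 : ℝ) ≤ K₀), hA]
    linarith
  -- mesh threshold
  set δ₀ : ℝ := min (β.im / 4) (min (β.im / (n₁ + 1)) (A / (6 * (2 * K₀ + 1)))) with hδ₀
  have hδ₀pos : 0 < δ₀ := lt_min (by positivity) (lt_min (by positivity) (by positivity))
  have hbound : ∀ δ : ℝ, 0 < δ → δ ≤ δ₀ →
      1 - (1 - c₁) ^ K₀ ≤ cornerCrossingProb t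
        ((rectQuad 0 (2 * A) 0 1 h2A one_pos).map (shearHomeomorph β hβ.ne')) δ := by
    intro δ hδ hδle
    have hδ1 : δ ≤ β.im / 4 := hδle.trans (min_le_left _ _)
    have hδ2 : δ ≤ β.im / (n₁ + 1) := hδle.trans ((min_le_right _ _).trans (min_le_left _ _))
    have hδ3 : δ ≤ A / (6 * (2 * K₀ + 1)) :=
      hδle.trans ((min_le_right _ _).trans (min_le_right _ _))
    have hδ2' : δ * (n₁ + 1) ≤ β.im := by
      rwa [le_div_iff₀ (by positivity : (0 : ℝ) < n₁ + 1)] at hδ2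
    have hδ3' : δ * (6 * (2 * K₀ + 1)) ≤ A := by
      rwa [le_div_iff₀ (by positivity : (0 : ℝ) < 6 * (2 * K₀ + 1))] at hδ3
    have hδ3'' : 12 * ((K₀ : ℝ) * δ) + 6 * δ ≤ A := by linarith [hδ3']
    -- the square side, in lattice units
    set n : ℕ := max n₁ ⌈β.im / δ⌉₊ with hn
    have hn₁ : n₁ ≤ n := le_max_left _ _
    have hnge : β.im / δ ≤ n := (Nat.le_ceil _).trans (by exact_mod_cast le_max_right _ _)
    have hnδle : (n : ℝ) * δ ≤ β.im + δ := by
      rcases le_total n₁ ⌈β.im / δ⌉₊ with h3 | h3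
      · have hle : n ≤ ⌈β.im / δ⌉₊ := by rw [hn]; exact max_le h3 le_rfl
        have h1 : ((⌈β.im / δ⌉₊ : ℕ) : ℝ) < β.im / δ + 1 := Nat.ceil_lt_add_one (by positivity)
        have h4 : (n : ℝ) < β.im / δ + 1 := lt_of_le_of_lt (by exact_mod_cast hle) h1
        have h5 : (n : ℝ) * δ < (β.im / δ + 1) * δ := mul_lt_mul_of_pos_right h4 hδ
        rw [add_mul, div_mul_cancel₀ _ hδ.ne', one_mul] at h5
        exact h5.le
      · have hle : n ≤ n₁ := by rw [hn]; exact max_le le_rfl h3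
        have h4 : (n : ℝ) ≤ n₁ := by exact_mod_cast hle
        have h5 : (n : ℝ) * δ ≤ n₁ * δ := mul_le_mul_of_nonneg_right h4 hδ.le
        nlinarith
    -- the boxes: spacing `L`, left columns `x k`, translations `wv k`
    set L : ℝ := n * δ + δ with hL
    have hL0 : 0 ≤ L := by positivity
    have hL2 : L ≤ β.im + 2 * δ := by rw [hL]; linarith
    set x : Fin K₀ → ℝ := fun k => max 0 β.re + δ + k * L with hx
    set wv : Fin K₀ → ℂ := fun k => (((x k / δ : ℝ) : ℂ) + ((0 / δ : ℝ) : ℂ) * I) with hwv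
    have hxlo : ∀ k, max 0 β.re + δ ≤ x k := fun k =>
      le_add_of_nonneg_right (by positivity)
    have hxhi : ∀ k, x k + n * δ ≤ min 0 β.re + 2 * A - δ := fun k => by
      have hk : ((k : ℕ) : ℝ) ≤ K₀ - 1 := by
        have h1 : ((k : ℕ) : ℝ) + 1 ≤ K₀ := by exact_mod_cast k.isLt
        linarith
      have h1 : ((k : ℕ) : ℝ) * L ≤ (K₀ - 1) * L := mul_le_mul_of_nonneg_right hk hL0
      have h3 : (K₀ : ℝ) * L ≤ K₀ * (β.im + 2 * δ) := mul_le_mul_of_nonneg_left hL2 (by positivity)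
      have e3 : (K₀ : ℝ) * (β.im + 2 * δ) = K₀ * β.im + 2 * (K₀ * δ) := by ring
      have e1 : ((K₀ : ℝ) - 1) * L = K₀ * L - L := by ring
      have hmm := max_sub_min_eq_abs β.re
      have hxk : x k = max 0 β.re + δ + k * L := rfl
      rw [hxk]
      rw [e1] at h1
      have hLe : L = n * δ + δ := hL
      linarith [h1, h3, e3, hmm, hKH, hδ3'', hr, hLe]
    -- each box crossing is a crude crossing
    have hincl : ∀ k, ∀ ω : BondConfig (Site 2), ω ⊆ (zdGraph 2).edgeSet →
        ω ∈ embTBCrossing (fun v => squareLatticeEmbedding.z v - wv k) n n →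
        ω ∈ embDomainCrossing squareLatticeEmbedding.z
          ((rectQuad 0 (2 * A) 0 1 h2A one_pos).map (shearHomeomorph β hβ.ne')).carrier δ
          (((rectQuad 0 (2 * A) 0 1 h2A one_pos).map (shearHomeomorph β hβ.ne')).arc 0)
          (((rectQuad 0 (2 * A) 0 1 h2A one_pos).map (shearHomeomorph β hβ.ne')).arc 2) := by
      intro k ω hω hmem
      have hxk := hxlo k
      have hxk' := hxhi k
      have hm0 := min_le_left (0 : ℝ) β.re
      have hm1 := min_le_right (0 : ℝ) β.re
      have hM0 := le_max_left (0 : ℝ) β.re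
      have hM1 := le_max_right (0 : ℝ) β.re
      refine stub_inscribedTB _ _ _ (δ := δ) (x₁ := x k)
        (x₂ := x k + n * δ) (y₁ := 0) (y₂ := β.im) (a := n) (b := n) hδ ?_ ?_ ?_ (by linarith)
        (by positivity) (by rw [add_sub_cancel_left, mul_div_cancel_right₀ _ hδ.ne'])
        (by rw [sub_zero]; exact hnge) ω hω hmem
      · intro q hq1 hq2 hq3 hq4
        rw [mem_shearedBox_carrier hβ h2A one_pos]
        have hs0 : 0 < q.im / β.im := div_pos hq3 hβ
        have hs1 : q.im / β.im < 1 := by rw [div_lt_one hβ]; exact hq4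
        have e : β.re * q.im / β.im = β.re * (q.im / β.im) := by ring
        have hb := min_le_mul_le_max (r := β.re) hs0 hs1
        rw [e, one_mul]
        exact ⟨hq3, hq4, by linarith [hb.2], by linarith [hb.1]⟩
      · intro q hq1 hq2 hq3 hq4
        exact (infDist_arc_zero_le hβ h2A one_pos ⟨by linarith, by linarith⟩ hq3.le).trans
          (by linarith)
      · intro q hq1 hq2 hq3 hq4
        have him : q.im ≤ 1 * β.im := by rw [one_mul]; exact hq4.le
        exact (infDist_arc_two_le hβ h2A one_pos ⟨by linarith, by linarith⟩ him).trans
          (by linarith)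
    -- independence lower bound
    have hre : ∀ k, (wv k).re = x k / δ := fun k => by simp [hwv]
    have hsep : ∀ i j : Fin K₀, i ≠ j →
        (wv i).re + n < (wv j).re ∨ (wv j).re + n < (wv i).re := by
      have hdiff : ∀ a b : Fin K₀, (a : ℕ) < (b : ℕ) → (wv a).re + n < (wv b).re := by
        intro a b hab
        rw [hre, hre, div_add' _ _ _ hδ.ne', div_lt_div_iff_of_pos_right hδ]
        have h' : ((a : ℕ) : ℝ) + 1 ≤ (b : ℕ) := by exact_mod_cast hab
        have e : x b - x a = (((b : ℕ) : ℝ) - (a : ℕ)) * L := by simp only [hx]; ring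
        have h1 : (1 : ℝ) * L ≤ (((b : ℕ) : ℝ) - (a : ℕ)) * L :=
          mul_le_mul_of_nonneg_right (by linarith) hL0
        rw [one_mul, ← e] at h1
        have hLe : L = n * δ + δ := hL
        linarith
      intro i j hij
      rcases lt_or_gt_of_ne (Fin.val_ne_of_ne hij) with h | h
      · exact Or.inl (hdiff i j h)
      · exact Or.inr (hdiff j i h)
    have hind : 1 - (1 - c₁) ^ K₀ ≤ (cornerPercolation t).real
        (⋃ k, embTBCrossing (fun v => squareLatticeEmbedding.z v - wv k) n n) :=
      stub_indepBoxes t wv (a := n) (b := n) (c := c₁) (by positivity) hsep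
        (fun k => hbox n hn₁ (wv k))
    refine hind.trans ?_
    rw [cornerCrossingProb_eq]
    refine cornerPercolation_real_le_of_edgeSet t fun ω hω hmem => ?_
    obtain ⟨k, hk⟩ := mem_iUnion.1 hmem
    exact hincl k ω hω hk
  have hev : ∀ᶠ δ in 𝓝[>] (0 : ℝ), 1 - (1 - c₁) ^ K₀ ≤ cornerCrossingProb t
      ((rectQuad 0 (2 * A) 0 1 h2A one_pos).map (shearHomeomorph β hβ.ne')) δ := by
    filter_upwards [Ioc_mem_nhdsGT hδ₀pos] with δ hδ
    exact hbound δ hδ.1 hδ.2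
  have hle : 1 - (1 - c₁) ^ K₀ ≤ p := ge_of_tendsto hlim hev
  linarith


/-- **A wide box whose Cardy value exceeds `1 - c`.** For `c > 0` there is a width `A > 0` such
that `F(1 - η A) > 1 - c`, where `η` is the rectangle-modulus function (strictly antitone from
`(0,∞)` onto `(0,1)`) and `F` Cardy's function (continuous on `[0,1]`, `F 1 = 1`). -/
theorem exists_width_cardy_gt {η : ℝ → ℝ} (himg : η '' Ioi 0 = Ioo 0 1) {c : ℝ} (hc : 0 < c) :
    ∃ A : ℝ, 0 < A ∧ η A ∈ Ioo (0 : ℝ) 1 ∧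
      1 - c < Literature.Probability.RandomPlanarGeometry.cardyFunction (1 - η A) := by
  have hFc : ContinuousWithinAt Literature.Probability.RandomPlanarGeometry.cardyFunction
      (Icc 0 1) 1 :=
    continuousOn_cardyFunction_holds 1 (right_mem_Icc.2 zero_le_one)
  rw [Metric.continuousWithinAt_iff] at hFc
  obtain ⟨θ, hθ, hFθ⟩ := hFc c hc
  set s : ℝ := min (θ / 2) (1 / 2) with hs
  have hs0 : 0 < s := lt_min (by positivity) (by norm_num)
  have hs1 : s < 1 := (min_le_right _ _).trans_lt (by norm_num)
  have hsθ : s < θ := (min_le_left _ _).trans_lt (by linarith)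
  have hsmem : s ∈ η '' Ioi 0 := by rw [himg]; exact ⟨hs0, hs1⟩
  obtain ⟨A, hA, hAs⟩ := hsmem
  refine ⟨A, hA, by rw [hAs]; exact ⟨hs0, hs1⟩, ?_⟩
  have h1 : dist (1 - η A) 1 < θ := by
    rw [hAs, Real.dist_eq]
    rw [show (1 : ℝ) - s - 1 = -s by ring, abs_neg, abs_of_pos hs0]
    exact hsθ
  have h2 := hFθ (x := 1 - η A) ⟨by rw [hAs]; linarith, by rw [hAs]; linarith⟩ h1
  rw [cardyFunction_one_holds, Real.dist_eq, abs_sub_lt_iff] at h2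
  linarith [h2.1, h2.2]

/-- **Moduli confinement from the uniform box-crossing property** (the lead's registered stub of
line `Sketch`): a compact `K ⊆ ℍ`, depending only on the UBC constants at aspect ratios `1/2`
and `1` and on Cardy's function, contains every `β ∈ ℍ` whose sheared boxes have crude `M_t`-
crossing probabilities converging to the Cardy values of the boxes. -/
theorem stub_confinement
    (hUBC : ∀ ρ : ℝ, 0 < ρ → ∃ c > 0, ∃ n₀ : ℕ, ∀ t : unitInterval,
      BoxCrossingBounds (cornerPercolation t) squareLatticeEmbedding.z ρ c n₀) :
    ∃ K : Set ℂ, IsCompact K ∧ K ⊆ {β | 0 < β.im} ∧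
      ∀ (t : unitInterval) (β : ℂ) (hβ : 0 < β.im),
        (∀ (w h : ℝ) (hw : 0 < w) (hh : 0 < h)
          (φ : ConformalEquiv upperHalfPlaneSet (rectQuad 0 w 0 h hw hh).carrier) (x : Fin 4 → ℝ),
          (rectQuad 0 w 0 h hw hh).IsUniformizing φ x →
          Tendsto (cornerCrossingProb t ((rectQuad 0 w 0 h hw hh).map (shearHomeomorph β hβ.ne')))
            (𝓝[>] 0) (𝓝 (Literature.Probability.RandomPlanarGeometry.cardyFunction (crossRatio x)))) →
        β ∈ K := by
  -- UBC at aspect ratios `1/2` and `1`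
  obtain ⟨c, hc, n₀, hB⟩ := hUBC (1 / 2) (by norm_num)
  obtain ⟨c₁, hc₁, n₁, hB₁⟩ := hUBC 1 one_pos
  -- the rectangle-modulus function and the two test widths
  obtain ⟨η, -, himg, hrect⟩ := rectangle_crossRatio_eq_of_aspectRatio_holds
  obtain ⟨A, hA, hηA, hpA⟩ := exists_width_cardy_gt himg hc
  have h2A : (0 : ℝ) < 2 * A := by positivity
  have hη2A : η (2 * A) ∈ Ioo (0 : ℝ) 1 := by
    rw [← himg]; exact ⟨2 * A, h2A, rfl⟩
  set p₂ : ℝ := Literature.Probability.RandomPlanarGeometry.cardyFunction (1 - η (2 * A)) with hp₂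
  have hp₂1 : p₂ < 1 := by
    have hmem : 1 - η (2 * A) ∈ Icc (0 : ℝ) 1 := ⟨by linarith [hη2A.2], by linarith [hη2A.1]⟩
    have hlt : 1 - η (2 * A) < 1 := by linarith [hη2A.1]
    have h := strictMonoOn_cardyFunction_holds hmem (right_mem_Icc.2 zero_le_one) hlt
    rwa [cardyFunction_one_holds] at h
  have hq : (0 : ℝ) < 1 - p₂ := by linarith
  have hq' : (1 : ℝ) - c₁ < 1 := by linarith
  obtain ⟨K₀, hK₀⟩ := exists_pow_lt_of_lt_one hq hq'
  -- the compact
  set h₀ : ℝ := A / (6 * (K₀ + 1)) with hh₀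
  have hh₀pos : 0 < h₀ := by positivity
  refine ⟨Icc (-(5 * A / 3)) (5 * A / 3) ×ℂ Icc h₀ (4 * A / 3),
    isCompact_Icc.reProdIm isCompact_Icc, fun β hβ => ?_, fun t β hβ hPB => ?_⟩
  · rw [mem_reProdIm] at hβ
    exact lt_of_lt_of_le hh₀pos hβ.2.1
  -- the wide box of width `A`
  obtain ⟨φ, x, hx⟩ := MarkedDomain.exists_isUniformizing_holds (rectQuad 0 A 0 1 hA one_pos)
  have hlimA := hPB A 1 hA one_pos φ x hx
  rw [stub_boxCrossRatio η hrect hA one_pos φ x hx, div_one] at hlimA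
  have hboxT : ∀ n : ℕ, n₀ ≤ n → ∀ w : ℂ, (cornerPercolation t).real
      (embTBCrossing (fun v => squareLatticeEmbedding.z v - w) n ((1 / 2 : ℝ) * n)) ≤ 1 - c :=
    fun n hn w => (hB t n hn w).2.2
  have hboxS : ∀ n : ℕ, n₀ ≤ n → ∀ w : ℂ, (cornerPercolation t).real
      (embRectCrossing (fun v => squareLatticeEmbedding.z v - w) ((1 / 2 : ℝ) * n) n) ≤ 1 - c :=
    fun n hn w => (hB t n hn w).1.2
  have hT := two_mul_im_sub_abs_re_le_of_gateTB t hβ hA hboxT hpA hlimA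
  have hS := abs_re_le_of_gateLR t hβ hA hboxS hpA hlimA
  have hr : |β.re| ≤ 5 * A / 3 := by linarith
  have hi : β.im ≤ 4 * A / 3 := by linarith
  -- the box of width `2A`
  obtain ⟨φ₂, x₂, hx₂⟩ :=
    MarkedDomain.exists_isUniformizing_holds (rectQuad 0 (2 * A) 0 1 h2A one_pos)
  have hlim2 := hPB (2 * A) 1 h2A one_pos φ₂ x₂ hx₂
  rw [stub_boxCrossRatio η hrect h2A one_pos φ₂ x₂ hx₂, div_one] at hlim2
  have hbox1 : ∀ n : ℕ, n₁ ≤ n → ∀ w : ℂ, c₁ ≤ (cornerPercolation t).real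
      (embTBCrossing (fun v => squareLatticeEmbedding.z v - w) n n) := by
    intro n hn w
    have h := (hB₁ t n hn w).2.1
    rwa [one_mul] at h
  have hF := im_ge_of_inscribed t hβ hA h2A hbox1 hr hK₀ hlim2
  rw [mem_reProdIm]
  exact ⟨abs_le.1 hr |>.imp (fun h => by linarith) (fun h => h), hF, hi⟩


/-- **Pull-back of the test box.** If `CardyMod t α` holds (`0 < im α`) then for every box
`(0,w)×(0,h)` with uniformizing datum `(φ, x)` the crude `M_t`-crossing probability of the
pre-sheared box `φ_β((0,w)×(0,h))`, `β = (i - re α)/im α` (so that `φ_α ∘ φ_β = id`), tends to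
`F(crossRatio x)`. -/
theorem pullback_constant {t : unitInterval} {α : ℂ} (hα : 0 < α.im)
    (hmod : ∀ (R R' : ConformalRectangle) (φ : ConformalEquiv upperHalfPlaneSet R.carrier)
      (x : Fin 4 → ℝ), R.carrier = moduliShear α '' R'.carrier →
      (∀ i, R.pt i = moduliShear α (R'.pt i)) → R.IsUniformizing φ x →
      Tendsto (cornerCrossingProb t R') (𝓝[>] 0) (𝓝 (Literature.Probability.RandomPlanarGeometry.cardyFunction (crossRatio x))))
    (hβ : 0 < ((I - (α.re : ℂ)) / (α.im : ℂ)).im)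
    (w h : ℝ) (hw : 0 < w) (hh : 0 < h)
    (φ : ConformalEquiv upperHalfPlaneSet (rectQuad 0 w 0 h hw hh).carrier) (x : Fin 4 → ℝ)
    (hx : (rectQuad 0 w 0 h hw hh).IsUniformizing φ x) :
    Tendsto (cornerCrossingProb t
      ((rectQuad 0 w 0 h hw hh).map (shearHomeomorph ((I - (α.re : ℂ)) / (α.im : ℂ)) hβ.ne')))
      (𝓝[>] 0) (𝓝 (Literature.Probability.RandomPlanarGeometry.cardyFunction (crossRatio x))) := by
  refine hmod _ _ φ x ?_ (fun i => ?_) hx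
  · rw [MarkedDomain.carrier_map, Set.image_image, coe_shearHomeomorph]
    conv_lhs => rw [← Set.image_id (rectQuad 0 w 0 h hw hh).carrier]
    refine Set.image_congr' fun z => ?_
    rw [moduliShear_moduliShear, moduliShear_invParam hα.ne', moduliShear_I_apply, id]
  · rw [MarkedDomain.pt_map, coe_shearHomeomorph, moduliShear_moduliShear,
      moduliShear_invParam hα.ne', moduliShear_I_apply]

/-- The inverse shear parameter `β = (i - re α)/im α` lies in `ℍ` when `α` does. -/
theorem invParam_im_pos {α : ℂ} (hα : 0 < α.im) : 0 < ((I - (α.re : ℂ)) / (α.im : ℂ)).im := by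
  rw [Complex.div_ofReal_im]
  simp only [sub_im, I_im, ofReal_im, sub_zero]
  exact div_pos one_pos hα

/-- **The crux from the stubs.** `SegmentClosed`: UBC → UM → `G` closed. Sequences: if
`t n ∈ G` with moduli `α n` and `t n → t₀`, the inverse parameters `β n` lie in the compact `K`
of `stub_confinement` (via `pullback_constant`), a subsequence converges to `β₀ ∈ K ⊆ ℍ`, the
moduli `α n = (i - re β n)/im β n` converge to `α₀ ∈ ℍ` along it, and `stub_identification`
gives `CardyMod t₀ α₀`. -/
theorem segmentClosed_of_stubs :
    Summit.CriticalPhenomena.CardyFormulaZ2.Theses.CardySelfDualSegment.SegmentClosed := by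
  intro hUBC hUM
  -- the route's `CardyMod`, over the tree's `cornerCrossingProb` (literally the route's `P`)
  set CM : unitInterval → ℂ → Prop := fun t α => ∀ (R R' : ConformalRectangle)
    (φ : ConformalEquiv upperHalfPlaneSet R.carrier) (x : Fin 4 → ℝ),
    R.carrier = moduliShear α '' R'.carrier → (∀ i, R.pt i = moduliShear α (R'.pt i)) →
    R.IsUniformizing φ x → Tendsto (cornerCrossingProb t R') (𝓝[>] 0)
      (𝓝 (Literature.Probability.RandomPlanarGeometry.cardyFunction (crossRatio x))) with hCM
  change IsClosed {t | ∃ α : ℂ, 0 < α.im ∧ CM t α}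
  have hUBC' : ∀ ρ : ℝ, 0 < ρ → ∃ c > 0, ∃ n₀ : ℕ, ∀ t : unitInterval,
      BoxCrossingBounds (cornerPercolation t) squareLatticeEmbedding.z ρ c n₀ := hUBC
  have hUM' : ∀ (t₀ : unitInterval) (R : ConformalRectangle) (ε : ℝ), 0 < ε → ∃ η > 0,
      ∀ s : unitInterval, dist s t₀ < η → ∀ δ : ℝ, 0 < δ →
        |cornerCrossingProb s R δ - cornerCrossingProb t₀ R δ| < ε := hUM
  obtain ⟨K, hKc, hKH, hconf⟩ := stub_confinement hUBC'
  refine IsSeqClosed.isClosed fun ts t₀ hts hlim => ?_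
  choose αs hαs using hts
  set βs : ℕ → ℂ := fun n => (I - ((αs n).re : ℂ)) / ((αs n).im : ℂ) with hβs_def
  have hβs : ∀ n, 0 < (βs n).im := fun n => invParam_im_pos (hαs n).1
  have hβK : ∀ n, βs n ∈ K := fun n =>
    hconf (ts n) (βs n) (hβs n) fun w h hw hh φ x hx =>
      pullback_constant (hαs n).1 (hαs n).2 (hβs n) w h hw hh φ x hx
  obtain ⟨β₀, hβ₀K, ψ, hψ, hβlim⟩ := hKc.tendsto_subseq hβK
  have hβ₀ : 0 < β₀.im := hKH hβ₀K
  set α₀ : ℂ := (I - (β₀.re : ℂ)) / (β₀.im : ℂ) with hα₀_def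
  have hα₀ : 0 < α₀.im := invParam_im_pos hβ₀
  -- the moduli along the subsequence converge to `α₀`
  have hinv : ∀ n, αs n = (I - ((βs n).re : ℂ)) / ((βs n).im : ℂ) := by
    intro n
    have him : (αs n).im ≠ 0 := (hαs n).1.ne'
    have him' : ((αs n).im : ℂ) ≠ 0 := ofReal_ne_zero.2 him
    apply Complex.ext
    · simp [hβs_def, Complex.div_ofReal_re, Complex.div_ofReal_im]
      field_simp
    · simp [hβs_def, Complex.div_ofReal_re, Complex.div_ofReal_im]
  have hαlim : Tendsto (αs ∘ ψ) atTop (𝓝 α₀) := by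
    have hcont : ContinuousAt (fun β : ℂ => (I - (β.re : ℂ)) / (β.im : ℂ)) β₀ := by
      have h1 : ContinuousAt (fun β : ℂ => (I - (β.re : ℂ))) β₀ := by fun_prop
      have h2 : ContinuousAt (fun β : ℂ => (β.im : ℂ)) β₀ := by fun_prop
      exact h1.div h2 (ofReal_ne_zero.2 hβ₀.ne')
    have h := hcont.tendsto.comp hβlim
    refine (tendsto_congr fun k => ?_).1 h
    simp only [Function.comp_apply]
    exact (hinv (ψ k)).symm
  refine ⟨α₀, hα₀, ?_⟩
  intro R R' φ x hc hp hu
  exact stub_identification cornerCrossingProb (ts ∘ ψ) t₀ (αs ∘ ψ) α₀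
    (hlim.comp hψ.tendsto_atTop) hαlim (fun n => (hαs (ψ n)).1) hα₀ (hUM' t₀)
    (fun n => (hαs (ψ n)).2) R R' φ x hc hp hu

end Summit.CriticalPhenomena.CardyFormulaZ2.Cruxes.SegmentClosed.Sketch

/-- **`SegmentClosed` (closes item stmt-CriticalPhenomena-5473)**: the route decl
`Summit.CriticalPhenomena.CardyFormulaZ2.Theses.CardySelfDualSegment.SegmentClosed` — assuming
the uniform box-crossing property of the corner models `M_t` along the self-dual segment and
uniform marginality, the set of parameters `t ∈ [0,1]` admitting a modulus `α ∈ ℍ` with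
`CardyMod t α` is closed. Proved by line `Sketch` (`segmentClosed_of_stubs`). -/
theorem Summit.CriticalPhenomena.CardyFormulaZ2.Theorems.segmentClosed_proof :
    Summit.CriticalPhenomena.CardyFormulaZ2.Theses.CardySelfDualSegment.SegmentClosed :=
  Summit.CriticalPhenomena.CardyFormulaZ2.Cruxes.SegmentClosed.Sketch.segmentClosed_of_stubs

end
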